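import Literature.AnabelianGeometry.SemiGraphs.Arithmetic
import Literature.AnabelianGeometry.SemiGraphs.AmbientVocabOfReal
import Mathlib.CategoryTheory.SingleObj
import Mathlib.Algebra.Group.PUnit
import HarnessLib

/-!
# [SemiAnbd] Def. 5.1 (i)(c) `Def51CondC` ("`H` acts trivially on the underlying semi-graph, with
# continuous outer representations") as a FACT-LIST row (F-2513): kernel closure census

Mochizuki, *Semi-graphs of anabelioids*, Publ. RIMS **42** (2006), §5, Def. 5.1 (i)(c) p. 62
[cite: MochizukiSemiAnbd2006, Def 5.1 (i)(c), p. 62].  abc-iut cell, D-0078 fact-proving wave, row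
F-2513 of tranche 184 (`plan/F-TRANCHES.tsv`; seat abc-iut-f-184); PROOF-ONLY companion of
`Arithmetic.lean` (abc-iut-L3-t3), where
`Def51CondC 𝓥 G PA ρ H` (a `structure … : Prop` over the §§1–3 container `𝓥 : SemiAnbdVocab Obj`, an
object `G`, a profinite group `PA = π̂₁(A)`, an action `ρ : PA →* Aut G` and an open subgroup `H`) is
condition (c) of the DEFINITION of a continuous action — a HYPOTHESIS on the datum `(𝔾, A, ρ_𝔾)`, not a
theorem.  No definition is introduced or restated; the shape follows the census file of row F-0263
(`ArithmeticDef51CondAClosures.lean`, condition (a)).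

WHAT IS RECORDED.

* `not_forall_def51CondC` — the UNIVERSAL CLOSURE of F-2513 is FALSE: at an explicit (junk) container
  over the one-object category of the group `Perm Bool`, whose arrows act tautologically on the
  two-element vertex set, the transposition — an element of the open subgroup `H = ⊤` of the finite
  discrete profinite group `Perm Bool` acting through the tautological `ρ` — moves a vertex, so (c)
  fails.
* `Def51CondC.anti` — for EVERY container: (c) at `H` implies (c) at every smaller open subgroup
  `H' ≤ H` (the clause "for some open subgroup `H ⊆ π̂₁(A)`" of Def. 5.1 (i) is stable under shrinking
  `H`, as the text uses silently).
* `def51CondC_of_le_ker` — for EVERY container in which the identity arrow fixes the branches of `G`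
  (hypothesis `hid`; automatic when `G` has no edges, `def51CondC_of_le_ker_of_isEmpty`, and at the
  REAL container `SemiAnbdVocab.ofReal R` of the tree, `ofReal_mapTotalBr_id` /
  `def51CondC_ofReal_of_le_ker`): if `H ≤ Ker ρ` then (c) holds at `H` — `H` fixes vertices and
  branches and every outer representation `H → Out(π̂₁(𝔾_v))` is constant, hence continuous; in
  particular the trivial action satisfies (c) at every `H` (`def51CondC_one`, `def51CondC_ofReal_one`).
* `not_forall_def51CondC_one` — the hypothesis `hid` is NOT redundant over an ARBITRARY container: the
  container `SemiAnbdVocab` carries no functoriality law for the branch maps `mapBr` (only for `mapV`,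
  `mapE`), so at a junk container whose identity arrow swaps the two branches of an edge even the
  TRIVIAL action violates (c).  (A remark on the interface, not on the paper: at the real container
  the identity fixes branches by `rfl`.)
* `def51CondC_both_ways` — summary: (c) takes both truth values.

FACT-LIST reading: F-2513 = «definition clause / hypothesis predicate on `(𝔾, A, ρ_𝔾, H)`; universal
closure REFUTED; inhabited (trivial action at the real container, any `H`)».  Nothing here asserts a
result of the paper; no side taken on [IUTchIII] Cor. 3.12; a FACT row is an assumption label;
typed ≠ proved.
-/

noncomputable section

namespace Literature.AnabelianGeometry.SemiGraphs

open _root_.CategoryTheory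

universe u v w

/-! ### Instance forms valid for every container -/

section AnyContainer

variable {Obj : Type u} [Category.{v} Obj] (𝓥 : SemiAnbdVocab.{u, v, w} Obj)
variable (G : Obj) (PA : ProfiniteGrp.{w}) (ρ : PA →* Aut G)

/-- The outer representation datum `outRep φ v _` of the container depends on the automorphism `φ`
only (congruence in `φ`, proof-irrelevance in the fixing witness).
[cite: MochizukiSemiAnbd2006, Def 5.1 (i)(c), p. 62] -/
theorem SemiAnbdVocab.outRep_congr {φ ψ : Aut G} (e : φ = ψ) (x : 𝓥.Vert G)
    (hφ : 𝓥.mapV φ.hom x = x) (hψ : 𝓥.mapV ψ.hom x = x) : 𝓥.outRep φ x hφ = 𝓥.outRep ψ x hψ := by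
  subst e
  rfl

/-- **Def 5.1 (i)(c) is stable under shrinking the open subgroup**: if `H` acts trivially on the
underlying semi-graph with continuous outer representations, so does every open `H' ≤ H` (the outer
representation of `H'` is the restriction of that of `H`).
[cite: MochizukiSemiAnbd2006, Def 5.1 (i)(c), p. 62] -/
theorem Def51CondC.anti {H H' : OpenSubgroup PA} (hle : H' ≤ H) (hC : Def51CondC 𝓥 G PA ρ H) :
    Def51CondC 𝓥 G PA ρ H' where
  fixesVert h hh x := hC.fixesVert h (hle hh) x
  fixesBr h hh x := hC.fixesBr h (hle hh) x
  continuous_outRep x := by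
    have hc := (hC.continuous_outRep x).comp
      (continuous_subtype_val.subtype_mk fun h : H' => (hle h.2 : (h.1 : PA) ∈ H))
    exact hc

/-- **Def 5.1 (i)(c) holds at every open `H ≤ Ker ρ_𝔾`**, for a container in which the identity arrow
of `G` fixes the branches of `G` (`hid`): such an `H` acts on `𝔾` through the identity, so it fixes
every vertex and every branch, and each outer representation `H → Out(π̂₁(𝔾_v))` is the constant map
to the class of the identity, which is continuous. [cite: MochizukiSemiAnbd2006, Def 5.1 (i)(c), p. 62] -/
theorem def51CondC_of_le_ker (H : OpenSubgroup PA)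
    (hid : ∀ x : (Σ e : 𝓥.Edge G, 𝓥.Br e), 𝓥.mapTotalBr (𝟙 G) x = x)
    (hH : (H : Subgroup PA) ≤ ρ.ker) : Def51CondC 𝓥 G PA ρ H := by
  have h1 : ∀ h ∈ H, ρ h = 1 := fun h hh => MonoidHom.mem_ker.mp (hH hh)
  have hhom : ∀ h ∈ H, (ρ h).hom = 𝟙 G := fun h hh => by rw [h1 h hh]; rfl
  refine ⟨fun h hh x => ?_, fun h hh x => ?_, fun x => ?_⟩
  · rw [hhom h hh]; exact 𝓥.mapV_id G x
  · rw [hhom h hh]; exact hid x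
  · exact (continuous_const (y := 𝓥.outRep (1 : Aut G) x (𝓥.mapV_id G x))).congr fun h =>
      (𝓥.outRep_congr G (h1 h.1 h.2) x _ (𝓥.mapV_id G x)).symm

/-- … in particular (no hypothesis on the container) when `G` has no edges.
[cite: MochizukiSemiAnbd2006, Def 5.1 (i)(c), p. 62] -/
theorem def51CondC_of_le_ker_of_isEmpty [IsEmpty (𝓥.Edge G)] (H : OpenSubgroup PA)
    (hH : (H : Subgroup PA) ≤ ρ.ker) : Def51CondC 𝓥 G PA ρ H :=
  def51CondC_of_le_ker 𝓥 G PA ρ H (fun x => isEmptyElim x.1) hH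

/-- **The trivial action satisfies Def 5.1 (i)(c) at every open subgroup** (container with `hid`).
[cite: MochizukiSemiAnbd2006, Def 5.1 (i)(c), p. 62] -/
theorem def51CondC_one (hid : ∀ x : (Σ e : 𝓥.Edge G, 𝓥.Br e), 𝓥.mapTotalBr (𝟙 G) x = x)
    (H : OpenSubgroup PA) : Def51CondC 𝓥 G PA 1 H :=
  def51CondC_of_le_ker 𝓥 G PA 1 H hid (by rw [MonoidHom.ker_one]; exact le_top)

end AnyContainer

/-! ### At the real container `SemiAnbdVocab.ofReal R` -/

section Real

universe v₁ u₁ u₂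

open SgAQuot

/-- At the real container the identity arrow fixes every branch (functoriality of the underlying
morphism of semi-graphs, by `rfl`). [cite: MochizukiSemiAnbd2006, §1, p. 11] -/
theorem SemiAnbdVocab.ofReal_mapTotalBr_id (R : SgA.BridgeResidual.{v₁, u₁, u₂}) (G : SgA.{v₁, u₁, u₂})
    (x : Σ e : (SemiAnbdVocab.ofReal R).Edge G, (SemiAnbdVocab.ofReal R).Br e) :
    (SemiAnbdVocab.ofReal R).mapTotalBr (𝟙 G) x = x := by
  obtain ⟨e, b⟩ := x
  rfl

/-- **Def 5.1 (i)(c) at the real container**: for every totally aloof, verticially slim semi-graph of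
anabelioids `𝔾` of the tree (object of `SgA`), every profinite `π̂₁(A)`, every action `ρ_𝔾` and every
open `H ≤ Ker ρ_𝔾`, condition (c) holds (relative to the residual datum `R` supplying
`Out(π̂₁(𝔾_v))`, on which the constant outer representation is continuous whatever `R` is).
[cite: MochizukiSemiAnbd2006, Def 5.1 (i)(c), p. 62] -/
theorem def51CondC_ofReal_of_le_ker (R : SgA.BridgeResidual.{v₁, u₁, u₂}) (G : SgA.{v₁, u₁, u₂})
    (PA : ProfiniteGrp.{u₂}) (ρ : PA →* Aut G) (H : OpenSubgroup PA)
    (hH : (H : Subgroup PA) ≤ ρ.ker) : Def51CondC (SemiAnbdVocab.ofReal R) G PA ρ H :=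
  def51CondC_of_le_ker _ G PA ρ H (SemiAnbdVocab.ofReal_mapTotalBr_id R G) hH

/-- **The trivial action on a real `𝔾` satisfies Def 5.1 (i)(c) at every open subgroup.**
[cite: MochizukiSemiAnbd2006, Def 5.1 (i)(c), p. 62] -/
theorem def51CondC_ofReal_one (R : SgA.BridgeResidual.{v₁, u₁, u₂}) (G : SgA.{v₁, u₁, u₂})
    (PA : ProfiniteGrp.{u₂}) (H : OpenSubgroup PA) : Def51CondC (SemiAnbdVocab.ofReal R) G PA 1 H :=
  def51CondC_one _ G PA (SemiAnbdVocab.ofReal_mapTotalBr_id R G) H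

end Real

/-! ### The universal closure is false -/

section Junk

/-- **F-2513 is a definition clause: its universal closure is FALSE.**  Witness: the junk container over
the one-object category of the group `Perm Bool` (arrows = permutations of `Bool`, acting
tautologically on the vertex set `Bool`; no edges; all localizations the object itself, all classes of
arrows everything), `π̂₁(A) := Perm Bool` (finite, discrete), `ρ` tautological, `H := ⊤`: the
transposition lies in `H` and moves the vertex `true`. [cite: MochizukiSemiAnbd2006, Def 5.1 (i)(c), p. 62] -/
theorem not_forall_def51CondC :
    ¬ ∀ (Obj : Type) [Category.{0} Obj] (𝓥 : SemiAnbdVocab.{0, 0, 0} Obj) (G : Obj)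
        (PA : ProfiniteGrp.{0}) (ρ : PA →* Aut G) (H : OpenSubgroup PA), Def51CondC 𝓥 G PA ρ H := by
  intro h
  letI : TopologicalSpace (Equiv.Perm Bool) := ⊥
  haveI : DiscreteTopology (Equiv.Perm Bool) := ⟨rfl⟩
  let 𝓥 : SemiAnbdVocab.{0, 0, 0} (SingleObj (Equiv.Perm Bool)) :=
    { Vert := fun _ => Bool
      Edge := fun _ => Empty
      Br := fun _ => Empty
      abut := fun b => b.elim
      natCard_br := fun e => e.elim
      mapV := fun f x => (show Bool ≃ Bool from f) x
      mapE := fun _ e => e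
      mapBr := @fun _ _ _ _ b => b
      mapBr_bijective := fun _ e => e.elim
      abut_mapBr := @fun _ _ _ _ b _ _ => b.elim
      mapV_id := fun _ _ => rfl
      mapV_comp := fun _ _ _ => rfl
      mapE_id := fun _ _ => rfl
      mapE_comp := fun _ _ _ => rfl
      locV := fun G _ => G
      locE := fun G _ => G
      locB := @fun G _ _ => G
      ιV := fun G _ => 𝟙 G
      ιE := fun G _ => 𝟙 G
      ιB := @fun G _ _ => 𝟙 G
      βV := @fun G _ _ _ _ => 𝟙 G
      βE := @fun G _ _ => 𝟙 G
      βV_ι := @fun _ _ _ _ _ => Category.comp_id _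
      βE_ι := @fun _ _ _ => Category.comp_id _
      centerV := fun _ x => x
      mapV_centerV := fun _ _ => rfl
      centerE := fun _ e => e
      mapE_centerE := fun _ _ => rfl
      locMapV := fun f _ _ _ => f
      locMapE := fun f _ _ _ => f
      locMapV_ι := fun f _ _ _ => by rw [Category.comp_id, Category.id_comp]
      locMapE_ι := fun f _ _ _ => by rw [Category.comp_id, Category.id_comp]
      locMapV_id := fun _ _ _ => rfl
      locMapV_comp := fun _ _ _ _ _ _ _ _ => rfl
      locMapE_id := fun _ _ _ => rfl
      locMapE_comp := fun _ _ _ _ _ _ _ _ => rfl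
      vertDegree := fun _ _ => 1
      OutVert := fun _ _ => ProfiniteGrp.of PUnit.{1}
      outRep := fun _ _ _ => 1
      IsOfInjectiveType := fun _ => True
      IsQuasiCoherent := fun _ => True
      IsCoherent := fun _ => True
      isQuasiCoherent_of_isCoherent := fun _ _ => trivial
      IsTotallyElevated := fun _ => True
      IsTotallyUnivSubcoverticial := fun _ => True
      IsTotallyEstranged := fun _ => True
      IsLocallyTrivial := fun _ => True
      IsLocallyFiniteEtale := fun _ => True
      IsFiniteEtale := fun _ => True
      IsTempered := fun _ => True
      isLocallyFiniteEtale_of_isLocallyTrivial := fun _ _ => trivial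
      isLocallyFiniteEtale_of_isFiniteEtale := fun _ _ => trivial
      isTempered_of_isFiniteEtale := fun _ _ => trivial
      isLocallyFiniteEtale_of_isTempered := fun _ _ => trivial
      isLocallyTrivial_id := fun _ => trivial
      isLocallyFiniteEtale_comp := fun _ _ _ _ => trivial
      isLocallyTrivial_ιV := fun _ _ => trivial
      isLocallyTrivial_ιE := fun _ _ => trivial
      isLocallyTrivial_βV := @fun _ _ _ _ _ => trivial
      isLocallyTrivial_βE := @fun _ _ _ => trivial
      isLocallyFiniteEtale_locMapV := fun _ _ _ _ _ => trivial
      isLocallyFiniteEtale_locMapE := fun _ _ _ _ _ => trivial }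
  let ρ : ProfiniteGrp.of (Equiv.Perm Bool) →* Aut (SingleObj.star (Equiv.Perm Bool)) :=
    { toFun := fun g => ⟨g, (g⁻¹ :),
        by rw [SingleObj.comp_as_mul, SingleObj.id_as_one]; exact inv_mul_cancel g,
        by rw [SingleObj.comp_as_mul, SingleObj.id_as_one]; exact mul_inv_cancel g⟩
      map_one' := Iso.ext rfl
      map_mul' := fun _ _ => Iso.ext rfl }
  have hc := h _ 𝓥 (SingleObj.star (Equiv.Perm Bool)) (ProfiniteGrp.of (Equiv.Perm Bool)) ρ ⊤
  have hfix := hc.fixesVert (Equiv.swap false true) (OpenSubgroup.mem_top _) true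
  have hft : (false : Bool) = true := (Equiv.swap_apply_right false true).symm.trans hfix
  exact Bool.false_ne_true hft

/-- **Without the hypothesis `hid`, even the TRIVIAL action can violate Def 5.1 (i)(c) over a junk
container**: the container `SemiAnbdVocab` has no functoriality law for the branch maps, and at the
container below (one vertex, one edge with branch set `Bool`, every arrow — the identity included —
acting on branches by negation) the clause "`H` fixes every branch" fails for `ρ = 1`, `H = ⊤`,
`π̂₁(A) = 1`.  (Interface remark only: at the real container the identity fixes branches,
`SemiAnbdVocab.ofReal_mapTotalBr_id`.) [cite: MochizukiSemiAnbd2006, Def 5.1 (i)(c), p. 62] -/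
theorem not_forall_def51CondC_one :
    ¬ ∀ (Obj : Type) [Category.{0} Obj] (𝓥 : SemiAnbdVocab.{0, 0, 0} Obj) (G : Obj)
        (PA : ProfiniteGrp.{0}) (H : OpenSubgroup PA), Def51CondC 𝓥 G PA 1 H := by
  intro h
  have hnot : Function.Bijective (fun b : Bool => !b) :=
    ⟨fun a b hab => Bool.not_inj hab, fun b => ⟨!b, Bool.not_not b⟩⟩
  let 𝓥 : SemiAnbdVocab.{0, 0, 0} (SingleObj (Equiv.Perm Bool)) :=
    { Vert := fun _ => Unit
      Edge := fun _ => Unit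
      Br := fun _ => Bool
      abut := fun _ => some ()
      natCard_br := fun _ => by simp
      mapV := fun _ x => x
      mapE := fun _ e => e
      mapBr := @fun _ _ _ _ b => !b
      mapBr_bijective := fun _ _ => hnot
      abut_mapBr := @fun _ _ _ _ _ _ hb => hb
      mapV_id := fun _ _ => rfl
      mapV_comp := fun _ _ _ => rfl
      mapE_id := fun _ _ => rfl
      mapE_comp := fun _ _ _ => rfl
      locV := fun G _ => G
      locE := fun G _ => G
      locB := @fun G _ _ => G
      ιV := fun G _ => 𝟙 G
      ιE := fun G _ => 𝟙 G
      ιB := @fun G _ _ => 𝟙 G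
      βV := @fun G _ _ _ _ => 𝟙 G
      βE := @fun G _ _ => 𝟙 G
      βV_ι := @fun _ _ _ _ _ => Category.comp_id _
      βE_ι := @fun _ _ _ => Category.comp_id _
      centerV := fun _ x => x
      mapV_centerV := fun _ _ => rfl
      centerE := fun _ e => e
      mapE_centerE := fun _ _ => rfl
      locMapV := fun f _ _ _ => f
      locMapE := fun f _ _ _ => f
      locMapV_ι := fun f _ _ _ => by rw [Category.comp_id, Category.id_comp]
      locMapE_ι := fun f _ _ _ => by rw [Category.comp_id, Category.id_comp]
      locMapV_id := fun _ _ _ => rfl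
      locMapV_comp := fun _ _ _ _ _ _ _ _ => rfl
      locMapE_id := fun _ _ _ => rfl
      locMapE_comp := fun _ _ _ _ _ _ _ _ => rfl
      vertDegree := fun _ _ => 1
      OutVert := fun _ _ => ProfiniteGrp.of PUnit.{1}
      outRep := fun _ _ _ => 1
      IsOfInjectiveType := fun _ => True
      IsQuasiCoherent := fun _ => True
      IsCoherent := fun _ => True
      isQuasiCoherent_of_isCoherent := fun _ _ => trivial
      IsTotallyElevated := fun _ => True
      IsTotallyUnivSubcoverticial := fun _ => True
      IsTotallyEstranged := fun _ => True
      IsLocallyTrivial := fun _ => True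
      IsLocallyFiniteEtale := fun _ => True
      IsFiniteEtale := fun _ => True
      IsTempered := fun _ => True
      isLocallyFiniteEtale_of_isLocallyTrivial := fun _ _ => trivial
      isLocallyFiniteEtale_of_isFiniteEtale := fun _ _ => trivial
      isTempered_of_isFiniteEtale := fun _ _ => trivial
      isLocallyFiniteEtale_of_isTempered := fun _ _ => trivial
      isLocallyTrivial_id := fun _ => trivial
      isLocallyFiniteEtale_comp := fun _ _ _ _ => trivial
      isLocallyTrivial_ιV := fun _ _ => trivial
      isLocallyTrivial_ιE := fun _ _ => trivial
      isLocallyTrivial_βV := @fun _ _ _ _ _ => trivial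
      isLocallyTrivial_βE := @fun _ _ _ => trivial
      isLocallyFiniteEtale_locMapV := fun _ _ _ _ _ => trivial
      isLocallyFiniteEtale_locMapE := fun _ _ _ _ _ => trivial }
  have hc := h _ 𝓥 (SingleObj.star (Equiv.Perm Bool)) (ProfiniteGrp.of PUnit.{1}) ⊤
  have hfix := hc.fixesBr 1 (OpenSubgroup.mem_top _) ⟨(), true⟩
  have hft : (false : Bool) = true :=
    congrArg (fun x : (Σ e : 𝓥.Edge (SingleObj.star (Equiv.Perm Bool)), 𝓥.Br e) => (x.2 : Bool)) hfix
  exact Bool.false_ne_true hft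

/-- Summary: Def 5.1 (i)(c) takes both truth values (trivial action on a real `𝔾`: true; the
transposition acting on a two-vertex junk container: false). [cite: MochizukiSemiAnbd2006, Def 5.1 (i)(c), p. 62] -/
theorem def51CondC_both_ways :
    (∀ (R : SgAQuot.SgA.BridgeResidual.{0, 0, 0}) (G : SgAQuot.SgA.{0, 0, 0}) (PA : ProfiniteGrp.{0})
        (H : OpenSubgroup PA), Def51CondC (SemiAnbdVocab.ofReal R) G PA 1 H) ∧
      ¬ ∀ (Obj : Type) [Category.{0} Obj] (𝓥 : SemiAnbdVocab.{0, 0, 0} Obj) (G : Obj)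
          (PA : ProfiniteGrp.{0}) (ρ : PA →* Aut G) (H : OpenSubgroup PA), Def51CondC 𝓥 G PA ρ H :=
  ⟨fun R G PA H => def51CondC_ofReal_one R G PA H, not_forall_def51CondC⟩

end Junk

end Literature.AnabelianGeometry.SemiGraphs

end
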